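import Summits.NavierStokesRegularity.NavierStokesRegularity.Theorems.ExtremiserTransienceNearExtremalTransienceExtremiserLiouvilleConstantSpeedEnergyFluxJet
import HarnessLib

/-!
# Crux `ExtremiserTransience.NearExtremalTransience` (stmt-NavierStokesRegularity-21883), line `extremiser_liouville`,
# stub K1b — THE JET DICHOTOMY (positive form): a non-trivial constant-speed divergence-free field is flat or a bi-infinite jet

`--supports stmt-NavierStokesRegularity-21883` (helper).  Author: prover seat `ns-el-k1b` (g5).  The quotable form of the
energy-flux invariance (`…ConstantSpeedEnergyFlux{,Invariance,Liouville,Jet}`):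

* `flat_or_jet_of_constSpeed` : **every `C¹` divergence-free field `w` on `ℝ³` with constant speed `‖w‖ ≡ ‖c‖`, `c ≠ 0`, which
  is not identically `c`, is either FLAT — some slab `{|⟪x,c⟫| ≤ T‖c‖}` has `∫‖w − c‖² = ∞` — or a BI-INFINITE JET — every slab
  is square integrable and the window energies along the far-field axis `E(s) = ∫ H′(⟪x,c⟫/‖c‖ − s)‖w x − c‖² dx`
  (`H = Real.smoothTransition`) are all equal to one constant `E₀ > 0`** (the backward volume flux `E₀/(2‖c‖)` of `w − c`
  crosses every plane orthogonal to `c`, on both sides of any bounded region).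

For the K1b residue object (constant-speed analytic extended extremiser with far field `c`, `Z > 0`) this is the dichotomy behind
`stub_noAnalyticExtremal_of_noJetObject`; no far-field hypothesis is needed for the dichotomy itself.

WHAT THIS IS NOT: K1b is NOT proved; nothing here proves NS regularity. [folklore]
-/

noncomputable section

open Set Filter Topology MeasureTheory Metric Function
open scoped ENNReal NNReal Topology InnerProductSpace RealInnerProductSpace ContDiff
open Literature.Analysis.FluidPDE Literature.Analysis

namespace Summit.NavierStokesRegularity.NavierStokesRegularity.Theorems

-- the problem directory repeats the summit name (`NavierStokesRegularity/NavierStokesRegularity`)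
set_option linter.dupNamespace false

namespace ExtremiserLiouville

/-- **THE JET DICHOTOMY.**  A `C¹` divergence-free field with constant speed `‖w‖ ≡ M = ‖c‖`, `c ≠ 0`, not identically `c`, is
FLAT (a slab orthogonal to `c` with infinite excess energy) or a BI-INFINITE JET (all slabs square integrable and constant window
energy `E₀ > 0` along `c`). [folklore] -/
theorem flat_or_jet_of_constSpeed {w : EuclideanSpace ℝ (Fin 3) → EuclideanSpace ℝ (Fin 3)} {c : EuclideanSpace ℝ (Fin 3)} {M : ℝ}
    (hw : ContDiff ℝ 1 w) (hdiv : VectorCalculus.IsDivFree w) (hM : ∀ x, ‖w x‖ = M) (hcM : ‖c‖ = M) (hc : c ≠ 0)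
    (hne : ∃ x, w x ≠ c) :
    (∃ T : ℝ, 0 < T ∧ ¬ Integrable (fun x => {x : EuclideanSpace ℝ (Fin 3) | |⟪x, c⟫| / ‖c‖ ≤ T}.indicator (fun x => ‖w x - c‖ ^ 2) x) volume) ∨
      ((∀ T : ℝ, 0 < T → Integrable (fun x => {x : EuclideanSpace ℝ (Fin 3) | |⟪x, c⟫| / ‖c‖ ≤ T}.indicator (fun x => ‖w x - c‖ ^ 2) x) volume) ∧
        ∃ E₀ : ℝ, 0 < E₀ ∧ ∀ s : ℝ, (∫ x, deriv Real.smoothTransition (⟪x, c⟫ / ‖c‖ - s) * ‖w x - c‖ ^ 2) = E₀) := by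
  by_cases hflat : ∃ T : ℝ, 0 < T ∧
      ¬ Integrable (fun x => {x : EuclideanSpace ℝ (Fin 3) | |⟪x, c⟫| / ‖c‖ ≤ T}.indicator (fun x => ‖w x - c‖ ^ 2) x) volume
  · exact Or.inl hflat
  · right
    have hslab : ∀ T : ℝ, 0 < T →
        Integrable (fun x => {x : EuclideanSpace ℝ (Fin 3) | |⟪x, c⟫| / ‖c‖ ≤ T}.indicator (fun x => ‖w x - c‖ ^ 2) x) volume := by
      intro T hT
      by_contra h
      exact hflat ⟨T, hT, h⟩
    refine ⟨hslab, ?_⟩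
    -- the window energies are all equal to `E₀ := E(0)`
    set E₀ : ℝ := ∫ x, deriv Real.smoothTransition (⟪x, c⟫ / ‖c‖ - 0) * ‖w x - c‖ ^ 2 with hE₀
    have hconst : ∀ s : ℝ, (∫ x, deriv Real.smoothTransition (⟪x, c⟫ / ‖c‖ - s) * ‖w x - c‖ ^ 2) = E₀ := by
      intro s
      have hT : 0 < |s| + 1 + 1 := by positivity
      exact integral_deriv_smoothTransition_axialCoord_mul_sq_eq hw hdiv hM hcM hc (T := |s| + 1 + 1)
        (by linarith) (by rw [abs_zero]; linarith [abs_nonneg s]) (hslab _ hT)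
    have hE₀0 : 0 ≤ E₀ := integral_nonneg fun x => mul_nonneg (Real.smoothTransition.monotone.deriv_nonneg) (sq_nonneg _)
    refine ⟨E₀, ?_, hconst⟩
    rcases hE₀0.lt_or_eq with h | h
    · exact h
    · -- `E₀ = 0`: all windows vanish, so `w ≡ c`, contradicting `hne`
      exfalso
      have hsmall : ∀ ε : ℝ, 0 < ε → ∃ s : ℝ, (∫ x, deriv Real.smoothTransition (⟪x, c⟫ / ‖c‖ - s) * ‖w x - c‖ ^ 2) < ε :=
        fun ε hε => ⟨0, by rw [← hE₀, ← h]; exact hε⟩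
      obtain ⟨x, hx⟩ := hne
      exact hx (eq_farField_of_constSpeed_of_smallWindow hw hdiv hM hcM hc hslab hsmall x)

end ExtremiserLiouville

end Summit.NavierStokesRegularity.NavierStokesRegularity.Theorems

end
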